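import Literature.Probability.RandomPlanarGeometry.SLERestrictionMartingale
import Literature.Probability.RandomPlanarGeometry.CritPercSLE
import Literature.Topology.PlaneTopology.HalfPlaneArc
import HarnessLib

/-!
# [LSW] Lemmas 6.2 and 6.3 for the SLE_{8/3} flow: hulls of simple curves, exit and hitting times

Level 3 of the decomposition of `Literature.Probability.RandomPlanarGeometry.sle_restriction_eightThirds` ([LSW] Thm. 6.1; plan in
`SLERestrictionMartingale`, whose hypotheses `h62 : sle_restrictionDeriv_frequently_gt A` and
`h63 : sle_restrictionDeriv_frequently_lt A` this file reduces to the printed deterministic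
lemmas: `h62` for `A ∈ 𝒬₊` to Lemma 6.2, vendored here as a named fact, and `h63` to the content
of Lemma 6.3 for `A`, a property of the hull), after

* G. F. Lawler, O. Schramm, W. Werner, *Conformal restriction: the chordal case*, J. Amer. Math.
  Soc. **16** (2003) 917–955, arXiv:math/0209343 (**[LSW]**), §6, Lemma 6.2:

"Let `A ∈ 𝒬₊`, let `W : [0, ∞) → ℝ` be continuous, and let `g_t` be the corresponding solution
of (2.5). Let `K_t` be the associated growing hull, and suppose that `⋃_{t>0} K_t ∩ A = ∅`. Let
`T(r) := sup{t ≥ 0 : K_t ⊂ r𝕌}` and `A_t = g_t(A)`. Then `lim_{r → ∞} g'_{A_{T(r)}}(W_{T(r)}) = 1`."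
(Proof in print: extremal length from `A' = A ∪ [a₀, a₁]` to the circle `|z| = r`, monotonicity
of `g_B'(W)` in `B`; not reproduced.)

Contents:

* `Literature.Loewner.closedHull W t = {z ∈ ℍ̄ : T_z ≤ t}` — [LSW]'s hull `K_t` in the CLOSED
  half-plane (§2: "`K_t := {z ∈ ℍ̄ : τ(z) ≤ t}`"), i.e. the tree's `Loewner.hull W t ⊆ ℍ`
  together with the swallowed real points; `Literature.Loewner.IsExitTime W r t` — "`t = T(r)`",
  spelled out as: `K_s ⊂ r𝕌` for `s < t` and `K_s ⊄ r𝕌` for `s > t`;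
* `Literature.Probability.RandomPlanarGeometry.Loewner.restrictionDeriv_exitTime_gt` — NAMED FACT, Lemma 6.2 (the half
  "`≥ 1 − ε` eventually in `r`" of the limit; `≤ 1` is (2.4)), with `g'_{A_t}(W_t)` written as
  `Φ'_{A_t − W_t}(0)` (`Loewner.slidHull`, `HasRestrictionDeriv`);
* `Literature.Probability.RandomPlanarGeometry.Loewner.IsGeneratedByCurve.hull_eq_image` — PROVED: **the hull of a chain generated by
  a simple curve is the curve**, `K_t = γ(0, t]` (the complement `ℍ ∖ γ[0, t]` is connected,
  `isConnected_upperHalfPlaneSet_diff_image` of `Literature.Topology.PlaneTopology.HalfPlaneArc`,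
  and unbounded, hence is its own unbounded component);
* `Literature.Probability.RandomPlanarGeometry.sle_restrictionDeriv_frequently_gt_of_isPlusHull` — PROVED: for `A ∈ 𝒬₊`, Lemma 6.2
  together with the Rohde–Schramm simplicity of the SLE_{8/3} trace
  (`CritPerc.ae_isSimpleTrace_sleTrace_of_le_four`), existence of the trace (`HasSLETrace`), its
  transience (`tendsto_norm_sleTrace_atTop`) and Lawler's identification of the swallowing of
  real points (`sle_swallowingTime_ofReal_eq_firstHit`) give the property
  `sle_restrictionDeriv_frequently_gt A` of `SLERestrictionMartingale`: almost surely on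
  `{γ ∩ A = ∅}` — where `K_t = γ(0, t] ∪ {0}` never meets `A`, no real point of `A` is
  swallowed, and the exit times `T(r)` exist and exhaust `[0, ∞)` — `Φ'_{A_t − W_t}(0) > 1 − ε`
  at the arbitrarily large times `T(r)`.

For [LSW] Lemma 6.3 (printed for the smooth hulls of [LSW] §2; the named fact "every smooth
`*`-hull has the property below" is vendored with that class downstream, file
`SLERestrictionSmooth`): the
hitting time `T_A = inf{t : K_t ∩ A ≠ ∅}` of a hull by the closed hulls
(`Literature.Probability.RandomPlanarGeometry.Loewner.IsHullHitTime`), the content of Lemma 6.3 as a property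
`Literature.Loewner.RestrictionDerivVanishesAtHit A` of the hull, and — PROVED — for simple SLE traces
the identification of `T_A` with the first hitting time of `A` by the trace together with the
hypothesis "`K_T ∩ A ∩ ℝ = ∅`" (`isHullHitTime_of_firstHit_eq`, `not_swallowingTime_ofReal_le`),
whence `h63` for every `*`-hull with that property
(`sle_restrictionDeriv_frequently_lt_of_vanishesAtHit`). The case `A ∈ 𝒬₋` of Lemma 6.2 ([LSW]:
"by symmetry") is `LoewnerReflection`.
-/

noncomputable section

open Set Filter Topology MeasureTheory Metric
open UpperHalfPlane (upperHalfPlaneSet isOpen_upperHalfPlaneSet)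
open scoped NNReal

namespace Literature.Probability.RandomPlanarGeometry

namespace Loewner

variable {W : ℝ≥0 → ℝ} {γ : ℝ≥0 → ℂ}

/-! ### The hull of a simple curve is the curve -/

/-- A connected unbounded set is its own unbounded component. [folklore] -/
theorem unboundedComponent_eq_self {U : Set ℂ} (hU : IsPreconnected U)
    (hUb : ¬ Bornology.IsBounded U) : unboundedComponent U = U := by
  refine Subset.antisymm (unboundedComponent_subset U) fun z hz ↦ ⟨hz, fun hb ↦ hUb ?_⟩
  exact hb.subset (hU.subset_connectedComponentIn hz Subset.rfl)

/-- **The hull of a Loewner chain generated by a simple curve is the curve**: if `γ` is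
injective with `γ(s) ∈ ℍ` for `s > 0` (and `γ 0 = W 0 ∈ ℝ`), then `K_t = γ(0, t]`: the open set
`ℍ ∖ γ[0, t]` is connected (`isConnected_upperHalfPlaneSet_diff_image`) and unbounded, so it is
the unbounded component whose complement defines `K_t`. Lawler (2005), §4.4; Rohde–Schramm
(2005), §1 (simple phase). [folklore] -/
theorem IsGeneratedByCurve.hull_eq_image (hγ : IsGeneratedByCurve W γ) (hs : IsSimpleTrace γ)
    (t : ℝ≥0) : hull W t = γ '' Ioc 0 t := by
  have h0 : (γ 0).im = 0 := by rw [hγ.apply_zero, Complex.ofReal_im]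
  have hconn := Literature.Topology.PlaneTopology.isConnected_upperHalfPlaneSet_diff_image hγ.continuous hs.1 h0 hs.2 t
  have hunb : ¬ Bornology.IsBounded (upperHalfPlaneSet \ γ '' Icc 0 t) := by
    intro hb
    obtain ⟨R, hR⟩ := (hb.union (isCompact_Icc.image hγ.continuous).isBounded).subset_closedBall 0
    have hz : ((|R| + 1 : ℝ) : ℂ) * Complex.I ∈
        upperHalfPlaneSet \ γ '' Icc 0 t ∪ γ '' Icc 0 t := by
      by_cases h : ((|R| + 1 : ℝ) : ℂ) * Complex.I ∈ γ '' Icc 0 t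
      · exact Or.inr h
      · refine Or.inl ⟨?_, h⟩
        show 0 < ((((|R| + 1 : ℝ) : ℂ)) * Complex.I).im
        simp only [Complex.mul_im, Complex.ofReal_re, Complex.I_im, mul_one, Complex.ofReal_im,
          Complex.I_re, mul_zero, add_zero]
        positivity
    have := hR hz
    rw [mem_closedBall, dist_zero_right, norm_mul, Complex.norm_real, Complex.norm_I, mul_one,
      Real.norm_eq_abs, abs_of_pos (by positivity)] at this
    linarith [le_abs_self R]
  rw [hγ.hull_eq t, unboundedComponent_eq_self hconn.isPreconnected hunb,
    sdiff_sdiff_right_self]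
  ext z
  simp only [Set.mem_inter_iff, mem_image, mem_Icc, mem_Ioc]
  constructor
  · rintro ⟨hz, s, ⟨hs0, hst⟩, rfl⟩
    refine ⟨s, ⟨?_, hst⟩, rfl⟩
    rcases hs0.eq_or_lt with h | h
    · exact absurd (h ▸ h0 : (γ s).im = 0) (ne_of_gt hz)
    · exact h
  · rintro ⟨s, ⟨hs0, hst⟩, rfl⟩
    exact ⟨hs.2 s hs0, s, ⟨hs0.le, hst⟩, rfl⟩

/-! ### The hull in the closed half-plane and the exit times `T(r)` ([LSW] §2, Lemma 6.2) -/

/-- **The Loewner hull in the closed half-plane**, `K_t = {z ∈ ℍ̄ : T_z ≤ t}` ([LSW] §2: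
"The evolving hull of the Loewner evolution is defined as `K_t := {z ∈ ℍ̄ : τ(z) ≤ t}`"): the
tree's hull `Loewner.hull W t = {z ∈ ℍ : T_z ≤ t}` together with the real points swallowed by
time `t` (real points flow on `ℝ` until swallowed, `Loewner.swallowingTime`).
[cite: LawlerSchrammWerner2003Restriction, §2 (chordal Loewner chains, K_t)] -/
def closedHull (W : ℝ≥0 → ℝ) (t : ℝ≥0) : Set ℂ :=
  {z : ℂ | 0 ≤ z.im ∧ swallowingTime W z ≤ (t : WithTop ℝ≥0)}

/-- The closed hull is the open hull plus swallowed points of the real line. [folklore] -/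
theorem mem_closedHull_iff {t : ℝ≥0} {z : ℂ} :
    z ∈ closedHull W t ↔ z ∈ hull W t ∨ z.im = 0 ∧ swallowingTime W z ≤ (t : WithTop ℝ≥0) := by
  simp only [closedHull, hull, mem_setOf_eq, upperHalfPlaneSet]
  constructor
  · rintro ⟨him, hT⟩
    rcases him.eq_or_lt with h | h
    · exact Or.inr ⟨h.symm, hT⟩
    · exact Or.inl ⟨h, hT⟩
  · rintro (⟨him, hT⟩ | ⟨him, hT⟩)
    · exact ⟨le_of_lt him, hT⟩
    · exact ⟨him.ge, hT⟩

/-- The open hull is contained in the closed hull. [folklore] -/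
theorem hull_subset_closedHull (W : ℝ≥0 → ℝ) (t : ℝ≥0) : hull W t ⊆ closedHull W t :=
  fun _ hz ↦ mem_closedHull_iff.2 (Or.inl hz)

/-- The closed hulls increase. [folklore] -/
theorem closedHull_mono (W : ℝ≥0 → ℝ) : Monotone (closedHull W) :=
  fun _ _ hst _ hz ↦ ⟨hz.1, hz.2.trans (WithTop.coe_le_coe.2 hst)⟩

/-- **`t` is the exit time `T(r) = sup{s ≥ 0 : K_s ⊂ r𝕌}` of the disc of radius `r`** ([LSW]
Lemma 6.2), spelled out without a supremum: the closed hulls stay inside the open disc `r𝕌`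
strictly before `t` and leave it strictly after `t` (the set `{s : K_s ⊂ r𝕌}` is an initial
segment of `[0, ∞)`, the hulls being increasing, so these two conditions say exactly that `t`
is its supremum, when finite). [cite: LawlerSchrammWerner2003Restriction, Lemma 6.2 (T(r))] -/
def IsExitTime (W : ℝ≥0 → ℝ) (r : ℝ) (t : ℝ≥0) : Prop :=
  (∀ s : ℝ≥0, s < t → closedHull W s ⊆ ball 0 r) ∧ ∀ s : ℝ≥0, t < s → ¬ closedHull W s ⊆ ball 0 r

/-- The supremum of a nonempty bounded set of "inside" times is an exit time. [folklore] -/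
theorem isExitTime_csSup {r : ℝ} {S : Set ℝ≥0} (hS : S = {s | closedHull W s ⊆ ball 0 r})
    (hne : S.Nonempty) (hbdd : BddAbove S) : IsExitTime W r (sSup S) := by
  refine ⟨fun s hs ↦ ?_, fun s hs hsub ↦ ?_⟩
  · obtain ⟨s', hs'S, hss'⟩ := exists_lt_of_lt_csSup hne hs
    rw [hS] at hs'S
    exact (closedHull_mono W hss'.le).trans hs'S
  · have : s ∈ S := by rw [hS]; exact hsub
    exact (le_csSup hbdd this).not_gt hs

/-- **`τ` is the hitting time `T = T_A = inf{t ≥ 0 : K_t ∩ A ≠ ∅}` of `A` by the closed hulls**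
([LSW] §5: "let `T = T_A = inf{t : K_t ∩ A ≠ ∅}`"; Lemma 6.3:
"`T := inf{t ≥ 0 : K_t ∩ A ≠ ∅} < ∞`"), spelled out without an infimum: the closed hulls miss
`A` strictly before `τ` and meet it strictly after `τ` (the hulls increase, so this says exactly
that `τ` is the infimum, when finite). The vocabulary of Lemma 6.3.
[cite: LawlerSchrammWerner2003Restriction, §5 (T_A) and Lemma 6.3] -/
def IsHullHitTime (W : ℝ≥0 → ℝ) (A : Set ℂ) (τ : ℝ≥0) : Prop :=
  (∀ s : ℝ≥0, s < τ → Disjoint (closedHull W s) A) ∧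
    ∀ s : ℝ≥0, τ < s → ¬ Disjoint (closedHull W s) A

/-- **The content of [LSW] Lemma 6.3 for the hull `A`**, as a PROPERTY of `A` (a parametric
`Prop`, not asserted): for every continuous driving function whose closed hulls first meet `A`
at the finite time `T` (`IsHullHitTime`) without having swallowed a real point of `A`
("`K_T ∩ A ∩ ℝ = ∅`"), `Φ'_{A_t − W_t}(0) = Φ_{A_t}'(W_t) → 0` as `t ↗ T` — "Let `A ∈ 𝒬*` be a
smooth hull. Suppose that `T := inf{t ≥ 0 : K_t ∩ A ≠ ∅} < ∞` and `K_T ∩ A ∩ ℝ = ∅`. Set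
`A_t := g_t(A)`, `t < T`. Then `lim_{t ↗ T} Φ_{A_t}'(W_t) = 0`." [LSW] prove it for SMOOTH hulls
(harmonic measure and the two arcs of `∂A` at the hitting point, where the smoothness of
`∂A ∩ ℍ` is used); the named fact "every smooth `*`-hull has this property" (Lemma 6.3 itself)
is vendored with the smooth hulls downstream, file `SLERestrictionSmooth`.
[cite: LawlerSchrammWerner2003Restriction, Lemma 6.3] -/
def RestrictionDerivVanishesAtHit (A : Set ℂ) : Prop :=
  ∀ {W : ℝ≥0 → ℝ}, Continuous W → ∀ τ : ℝ≥0, IsHullHitTime W A τ →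
    (∀ x : ℝ, (x : ℂ) ∈ A → ¬ swallowingTime W x ≤ (τ : WithTop ℝ≥0)) →
      ∀ ε : ℝ, 0 < ε → ∀ᶠ t : ℝ≥0 in 𝓝[<] τ,
        ∀ (Ψ : ConformalEquiv (upperHalfPlaneSet \ slidHull W A t) upperHalfPlaneSet) (e : ℝ),
          IsRestrictionMap (slidHull W A t) Ψ → HasRestrictionDeriv (slidHull W A t) Ψ e →
            e < ε

/-- NAMED FACT — **[LSW] Lemma 6.2.** For `A ∈ 𝒬₊`, a continuous driving function `W` with
Loewner hulls `K_t` (in `ℍ̄`) such that `⋃_t K_t ∩ A = ∅`, and the exit times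
`T(r) = sup{t : K_t ⊂ r𝕌}`: "`lim_{r → ∞} g'_{A_{T(r)}}(W_{T(r)}) = 1`", `A_t = g_t(A)`. Here
`g'_{A_t}(W_t) = Φ'_{A_t − W_t}(0)` is written with the slid hull `A_t − W_t`
(`Loewner.slidHull`) and the predicates `IsRestrictionMap` / `HasRestrictionDeriv` of
`RestrictionHulls` (any restriction data of the slid hull), and the limit is stated as its
lower half "for every `ε > 0`, for all large `r`, at every exit time `t = T(r)`,
`g'_{A_t}(W_t) > 1 − ε`" (the upper bound `≤ 1` being [LSW] (2.4)). Proof in print: extremal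
length. [cite: LawlerSchrammWerner2003Restriction, Lemma 6.2] -/
def restrictionDeriv_exitTime_gt : Prop :=
  ∀ {W : ℝ≥0 → ℝ}, Continuous W → ∀ {A : Set ℂ}, IsPlusHull A →
    (∀ t, Disjoint (closedHull W t) A) →
      ∀ ε : ℝ, 0 < ε → ∃ r₀ : ℝ, ∀ r : ℝ, r₀ ≤ r → ∀ t : ℝ≥0, IsExitTime W r t →
        ∀ (Ψ : ConformalEquiv (upperHalfPlaneSet \ slidHull W A t) upperHalfPlaneSet) (e : ℝ),
          IsRestrictionMap (slidHull W A t) Ψ → HasRestrictionDeriv (slidHull W A t) Ψ e →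
            1 - ε < e

end Loewner

/-! ### The SLE_{8/3} corollary: `h62` for `A ∈ 𝒬₊` -/

section SLE

variable {A : Set ℂ}

/-- A real ray pointing away from `0` is never hit by a simple trace from `0`. [folklore] -/
theorem firstHit_realRay_eq_top {γ : ℝ≥0 → ℂ} (hs : Loewner.IsSimpleTrace γ) (h0 : γ 0 = 0)
    {x : ℝ} (hx : x ≠ 0) : firstHit γ (realRay x) = ⊤ := by
  refine firstHit_eq_top fun t ht ↦ ?_
  rcases eq_or_ne t 0 with rfl | ht0
  · rw [h0, mem_realRay_iff] at ht
    rcases lt_or_gt_of_ne hx with hx' | hx'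
    · have := ht.2.2 hx'
      simp at this
      linarith
    · have := ht.2.1 hx'
      simp at this
      linarith
  · have him := hs.2 t (pos_iff_ne_zero.2 ht0)
    rw [mem_realRay_iff] at ht
    exact absurd ht.1 (ne_of_gt him)

/-- For a sample path whose SLE_κ chain is generated by a simple trace, no real point other than
the origin is ever swallowed (swallowing = hitting the real ray, `hswallow` =
`sle_swallowingTime_ofReal_eq_firstHit`, Lawler (2005) Rem. 6.6). [cite: Lawler2005, Rem. 6.6] -/
theorem swallowingTime_ofReal_eq_top (hswallow : sle_swallowingTime_ofReal_eq_firstHit)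
    {κ : ℝ≥0} {ω : ℝ≥0 → ℝ} (hgen : Loewner.IsGeneratedByCurve (sleDriving κ ω) (sleTrace κ ω))
    (hs : Loewner.IsSimpleTrace (sleTrace κ ω)) {x : ℝ} (hx : x ≠ 0) :
    Loewner.swallowingTime (sleDriving κ ω) x = ⊤ := by
  rw [hswallow κ ω hgen hx]
  refine firstHit_realRay_eq_top hs ?_ hx
  rw [hgen.apply_zero, sleDriving_zero, Complex.ofReal_zero]

/-- **The closed hull of a simple SLE trace is `γ(0, t] ∪ {0}`**, in the form: it is contained
in `γ[0, t]`. [folklore] -/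
theorem closedHull_subset_image (hswallow : sle_swallowingTime_ofReal_eq_firstHit)
    {κ : ℝ≥0} {ω : ℝ≥0 → ℝ} (hgen : Loewner.IsGeneratedByCurve (sleDriving κ ω) (sleTrace κ ω))
    (hs : Loewner.IsSimpleTrace (sleTrace κ ω)) (t : ℝ≥0) :
    Loewner.closedHull (sleDriving κ ω) t ⊆ sleTrace κ ω '' Icc 0 t := by
  intro z hz
  rcases Loewner.mem_closedHull_iff.1 hz with h | ⟨him, hT⟩
  · rw [hgen.hull_eq_image hs t] at h
    exact image_mono Ioc_subset_Icc_self h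
  · -- a real point swallowed by time `t` is the origin `γ 0`
    have hz0 : z = 0 := by
      by_contra hz0
      have hx : z.re ≠ 0 := fun h ↦ hz0 (Complex.ext h him)
      have hzx : z = (z.re : ℂ) := Complex.ext (by simp) (by simp [him])
      rw [hzx, swallowingTime_ofReal_eq_top hswallow hgen hs hx] at hT
      exact WithTop.not_top_le_coe t hT
    refine ⟨0, ⟨le_rfl, bot_le⟩, ?_⟩
    rw [hz0]
    change Loewner.trace (sleDriving κ ω) 0 = 0
    rw [Loewner.trace_zero, sleDriving_zero, Complex.ofReal_zero]

/-- **The hulls of a simple SLE trace avoiding `A` never meet `A`** (`⋃_t K_t ∩ A = ∅`):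
`K_t ⊆ γ[0, t]` (points of `ℍ` in `K_t = γ(0, t]` are on the curve, and the only real point
ever swallowed is `γ 0 = 0`). [folklore] -/
theorem disjoint_closedHull (hswallow : sle_swallowingTime_ofReal_eq_firstHit)
    {κ : ℝ≥0} {ω : ℝ≥0 → ℝ} (hgen : Loewner.IsGeneratedByCurve (sleDriving κ ω) (sleTrace κ ω))
    (hs : Loewner.IsSimpleTrace (sleTrace κ ω)) (hγA : Disjoint (range (sleTrace κ ω)) A)
    (t : ℝ≥0) :
    Disjoint (Loewner.closedHull (sleDriving κ ω) t) A := by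
  refine Set.disjoint_left.2 fun z hz hzA ↦ ?_
  obtain ⟨s, -, rfl⟩ := closedHull_subset_image hswallow hgen hs t hz
  exact Set.disjoint_left.1 hγA (mem_range_self s) hzA

/-- **For a simple SLE trace, the first hitting time of a closed `A ∌ 0` by the trace is the
hitting time of `A` by the closed hulls** (`K_s ⊆ γ[0, s]` misses `A` for `s < T`, and
`γ(T) ∈ K_s ∩ A` for `s > T`): the hypothesis "`T < ∞`" of [LSW] Lemma 6.3 on the event
`{T < ∞}`. [folklore] -/
theorem isHullHitTime_of_firstHit_eq (hswallow : sle_swallowingTime_ofReal_eq_firstHit)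
    {κ : ℝ≥0} {ω : ℝ≥0 → ℝ} (hgen : Loewner.IsGeneratedByCurve (sleDriving κ ω) (sleTrace κ ω))
    (hs : Loewner.IsSimpleTrace (sleTrace κ ω)) (hA : IsClosed A) (h0 : (0 : ℂ) ∉ A) {τ : ℝ≥0}
    (hτ : firstHit (sleTrace κ ω) A = τ) : Loewner.IsHullHitTime (sleDriving κ ω) A τ := by
  set γ := sleTrace κ ω with hγ
  refine ⟨fun s hs' ↦ Set.disjoint_left.2 fun z hz hzA ↦ ?_, fun s hs' hdisj ↦ ?_⟩
  · obtain ⟨u, hu, rfl⟩ := closedHull_subset_image hswallow hgen hs s hz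
    refine notMem_of_lt_firstHit (γ := γ) ?_ hzA
    rw [hτ, WithTop.coe_lt_coe]
    exact hu.2.trans_lt hs'
  · -- the hitting time is attained and positive
    obtain ⟨t₀, ht₀, hmem⟩ := exists_firstHit_eq_coe (continuous_sleTrace κ ω) hA
      (by rw [hτ]; exact WithTop.coe_ne_top)
    have ht₀τ : t₀ = τ := by
      rw [hτ] at ht₀
      exact (WithTop.coe_eq_coe.1 ht₀).symm
    subst ht₀τ
    have hpos : 0 < t₀ := by
      have h := firstHit_sleTrace_pos κ hA h0 ω
      rw [ht₀, WithTop.coe_pos] at h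
      exact h
    refine Set.disjoint_left.1 hdisj ?_ hmem
    refine Loewner.hull_subset_closedHull _ _ ?_
    rw [hgen.hull_eq_image hs s]
    exact ⟨t₀, ⟨hpos, hs'.le⟩, rfl⟩

/-- **For a simple SLE trace no real point of `A ∌ 0` is swallowed** (by any time): the
hypothesis "`K_T ∩ A ∩ ℝ = ∅`" of [LSW] Lemma 6.3. [folklore] -/
theorem not_swallowingTime_ofReal_le (hswallow : sle_swallowingTime_ofReal_eq_firstHit)
    {κ : ℝ≥0} {ω : ℝ≥0 → ℝ} (hgen : Loewner.IsGeneratedByCurve (sleDriving κ ω) (sleTrace κ ω))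
    (hs : Loewner.IsSimpleTrace (sleTrace κ ω)) (h0 : (0 : ℂ) ∉ A) {x : ℝ} (hx : (x : ℂ) ∈ A)
    (τ : ℝ≥0) : ¬ Loewner.swallowingTime (sleDriving κ ω) x ≤ (τ : WithTop ℝ≥0) := by
  have hx0 : x ≠ 0 := by
    rintro rfl
    exact h0 (by simpa using hx)
  rw [swallowingTime_ofReal_eq_top hswallow hgen hs hx0]
  exact WithTop.not_top_le_coe τ

/-- **Exit times exist beyond any given time** for a transient simple SLE trace: given `a`,
some disc `r𝕌` contains `K_a ⊆ γ[0, a]`, and its exit time `T(r) ≥ a` exists because the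
trace eventually leaves `r𝕌`. [folklore] -/
theorem exists_isExitTime_ge (hswallow : sle_swallowingTime_ofReal_eq_firstHit)
    {κ : ℝ≥0} {ω : ℝ≥0 → ℝ} (hgen : Loewner.IsGeneratedByCurve (sleDriving κ ω) (sleTrace κ ω))
    (hs : Loewner.IsSimpleTrace (sleTrace κ ω))
    (htr : Tendsto (fun t ↦ ‖sleTrace κ ω t‖) atTop atTop) (a : ℝ≥0) (r₀ : ℝ) :
    ∃ r : ℝ, r₀ ≤ r ∧ ∃ t : ℝ≥0, a ≤ t ∧ Loewner.IsExitTime (sleDriving κ ω) r t := by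
  set γ := sleTrace κ ω with hγ
  -- a disc containing `γ[0, a]`
  obtain ⟨R, hR⟩ :=
    (isCompact_Icc.image hgen.continuous : IsCompact (γ '' Icc 0 a)).isBounded.subset_ball 0
  set r : ℝ := max r₀ R with hr
  refine ⟨r, le_max_left _ _, ?_⟩
  set S : Set ℝ≥0 := {s | Loewner.closedHull (sleDriving κ ω) s ⊆ ball 0 r} with hS
  have haS : a ∈ S := (closedHull_subset_image hswallow hgen hs a).trans
    (hR.trans (ball_subset_ball (le_max_right _ _)))
  -- the trace leaves the disc at some time `s₁`, which bounds `S`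
  obtain ⟨s₁, hs₁⟩ : ∃ s₁ : ℝ≥0, ∀ s, s₁ ≤ s → r < ‖γ s‖ := by
    have := htr.eventually (eventually_gt_atTop r)
    rw [eventually_atTop] at this
    exact this
  have hbdd : BddAbove S := by
    refine ⟨max s₁ 1, fun s hsS ↦ ?_⟩
    by_contra hlt
    push Not at hlt
    have hs₁s : s₁ ≤ max s₁ 1 := le_max_left _ _
    have hpos : (0 : ℝ≥0) < max s₁ 1 := lt_max_of_lt_right one_pos
    -- `γ (max s₁ 1) ∈ K_s` but has norm `> r`
    have hmem : γ (max s₁ 1) ∈ Loewner.closedHull (sleDriving κ ω) s := by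
      refine Loewner.hull_subset_closedHull _ _ ?_
      rw [hgen.hull_eq_image hs s]
      exact ⟨max s₁ 1, ⟨hpos, hlt.le⟩, rfl⟩
    have h1 := hsS hmem
    rw [mem_ball, dist_zero_right] at h1
    exact (lt_irrefl _ ((hs₁ _ hs₁s).trans h1))
  exact ⟨sSup S, le_csSup hbdd haS, Loewner.isExitTime_csSup hS ⟨a, haS⟩ hbdd⟩

/-- **[LSW] Lemma 6.2 for SLE_{8/3} and `A ∈ 𝒬₊`: the property
`sle_restrictionDeriv_frequently_gt A`.** Almost surely, on the event that the trace never hits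
`A`, `Φ'_{A_t − W_t}(0) > 1 − ε` at arbitrarily large times, namely at the exit times `T(r)`,
`r → ∞`. From the named fact `Loewner.restrictionDeriv_exitTime_gt` (Lemma 6.2, hypothesis
`h62`) and the facts that the SLE_{8/3} chain is generated by its trace (`hgen` = `HasSLETrace`,
Rohde–Schramm Thm. 5.1), that the trace is simple (`h₆` =
`CritPerc.ae_isSimpleTrace_sleTrace_of_le_four`, Rohde–Schramm Thm. 6.1) and transient (`htr` =
`tendsto_norm_sleTrace_atTop`, Rohde–Schramm Thm. 7.1), and that swallowing of real points is
hitting of real rays (`hswallow` = `sle_swallowingTime_ofReal_eq_firstHit`, Lawler Rem. 6.6).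
[cite: LawlerSchrammWerner2003Restriction, Lemma 6.2 and proof of Thm. 6.1 (§6)] -/
theorem sle_restrictionDeriv_frequently_gt_of_isPlusHull
    (h62 : Loewner.restrictionDeriv_exitTime_gt) (hgen : HasSLETrace ((8 : ℝ≥0) / 3))
    (h₆ : RandomPlanarGeometry.ae_isSimpleTrace_sleTrace_of_le_four (κ := (8 : ℝ≥0) / 3))
    (htr : tendsto_norm_sleTrace_atTop) (hswallow : sle_swallowingTime_ofReal_eq_firstHit)
    (hA : IsPlusHull A) : sle_restrictionDeriv_frequently_gt A := by
  have hκ0 : (0 : ℝ≥0) < 8 / 3 := by positivity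
  have hκ4 : (8 : ℝ≥0) / 3 ≤ 4 := by
    rw [div_le_iff₀ (by norm_num : (0 : ℝ≥0) < 3)]
    norm_num
  filter_upwards [ae_isGeneratedByCurve_sleTrace hgen, h₆ hκ0 hκ4, htr hκ0] with ω hgenω hsω htrω
    hT ε hε
  have hdisj : ∀ t, Disjoint (Loewner.closedHull (sleDriving ((8 : ℝ≥0) / 3) ω) t) A :=
    disjoint_closedHull hswallow hgenω hsω (firstHit_eq_top_iff_disjoint.1 hT)
  obtain ⟨r₀, hr₀⟩ := h62 (continuous_sleDriving _ ω) hA hdisj ε hε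
  rw [frequently_atTop]
  intro a
  obtain ⟨r, hr, t, hat, ht⟩ := exists_isExitTime_ge hswallow hgenω hsω htrω a r₀
  exact ⟨t, hat, hr₀ r hr t ht⟩

/-- **[LSW] Lemma 6.3 for SLE_{8/3}: the property `sle_restrictionDeriv_frequently_lt A`** (the
hypothesis `h63` of `sle_restriction_eightThirds_of_limits`) for every `*`-hull `A` having the
deterministic property `Loewner.RestrictionDerivVanishesAtHit A` (Lemma 6.3, printed for smooth
hulls): almost surely the chain is generated by the simple transient trace, the hitting time of
`A` by the closed hulls is the first hitting time `T` of `A` by the trace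
(`isHullHitTime_of_firstHit_eq`), and no real point of `A` is ever swallowed
(`not_swallowingTime_ofReal_le`), so Lemma 6.3 applies on `{T < ∞}`.
[cite: LawlerSchrammWerner2003Restriction, Lemma 6.3 and proof of Thm. 6.1 (§6)] -/
theorem sle_restrictionDeriv_frequently_lt_of_vanishesAtHit (hgen : HasSLETrace ((8 : ℝ≥0) / 3))
    (h₆ : RandomPlanarGeometry.ae_isSimpleTrace_sleTrace_of_le_four (κ := (8 : ℝ≥0) / 3))
    (hswallow : sle_swallowingTime_ofReal_eq_firstHit) (hA : IsStarHull A)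
    (h63 : Loewner.RestrictionDerivVanishesAtHit A) : sle_restrictionDeriv_frequently_lt A := by
  have hκ0 : (0 : ℝ≥0) < 8 / 3 := by positivity
  have hκ4 : (8 : ℝ≥0) / 3 ≤ 4 := by
    rw [div_le_iff₀ (by norm_num : (0 : ℝ≥0) < 3)]
    norm_num
  filter_upwards [ae_isGeneratedByCurve_sleTrace hgen, h₆ hκ0 hκ4] with ω hgenω hsω τ hτ ε hε
  have hτ0 : 0 < τ := by
    have h := firstHit_sleTrace_pos ((8 : ℝ≥0) / 3) hA.isBoundedHull.isClosed hA.zero_notMem ω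
    rw [hτ] at h
    exact_mod_cast h
  haveI : (𝓝[<] τ).NeBot := nhdsLT_neBot_of_exists_lt ⟨0, hτ0⟩
  exact (h63 (continuous_sleDriving _ ω) τ
    (isHullHitTime_of_firstHit_eq hswallow hgenω hsω hA.isBoundedHull.isClosed hA.zero_notMem hτ)
    (fun x hx ↦ not_swallowingTime_ofReal_le hswallow hgenω hsω hA.zero_notMem hx τ) ε
    hε).frequently

end SLE

end Literature.Probability.RandomPlanarGeometry

end
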